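import Mathlib
import Summits.RiemannHypothesis.RiemannHypothesis.Theorems.WeilGroundStateArchimedeanWindowSimpleEvenTrial2
import HarnessLib

/-!
# `GroundStateSimpleEven` — stub `stub_archTailBound`: an elementary bound for the archimedean tail

For `0 < b ≤ 1` (in fact for every `0 < b`),
`π/2 − arctan(e^b) + (1/2) log((e^b+1)/(e^b−1)) ≤ π/4 + (log 2)/2 − (log b)/2 − b/2 + b²/24 + b³/12`.
The left side is the closed form of the tail `∫_{2b}^∞ e^{t/2}/(2 sinh t) dt` of the archimedean
jump density. The bound is the sum of two independent elementary inequalities: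

* (A) `arctan(e^b) ≥ π/4 + b/2 − b³/12` for `b ≥ 0`: the difference vanishes at `0` and has
  derivative `1/(2 cosh b) − 1/2 + b²/4 ≥ 0`, because `cosh b ≤ e^{b²/2}` and `1 − b²/2 ≤ e^{−b²/2}`.
* (B) `log((e^b+1)/(e^b−1)) ≤ log 2 − log b + b²/12` for `b > 0`: from the Bernoulli/Padé bound
  `b (e^b + 1) ≤ 2 (1 + b²/12)(e^b − 1)` (i.e. `x coth x ≤ 1 + x²/3` at `x = b/2`, a rewriting of
  `WeilGroundState.exp_neg_mul_le_pade`) and `1 + b²/12 ≤ e^{b²/12}`.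

Route `RiemannHypothesis/WeilGroundState`, item `GroundStateSimpleEven` (stmt-RiemannHypothesis-1526),
line parity-multiplicity-commutator.
-/

namespace Summit.RiemannHypothesis.RiemannHypothesis.Theorems

namespace GroundStateSimpleEven

open Real Set Filter

set_option linter.dupNamespace false in
/-- The Bernoulli/Padé bound `x (e^x + 1) ≤ 2 (1 + x²/12)(e^x − 1)` for `x ≥ 0`
(i.e. `(x/2) coth(x/2) ≤ 1 + x²/12`), from `e^{-x}(1 + x/2 + x²/12) ≤ 1 − x/2 + x²/12`. [folklore] -/
theorem tail_mul_exp_add_one_le {x : ℝ} (hx : 0 ≤ x) :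
    x * (Real.exp x + 1) ≤ 2 * (1 + x ^ 2 / 12) * (Real.exp x - 1) := by
  have h := WeilGroundState.exp_neg_mul_le_pade hx
  rw [Real.exp_neg, inv_mul_le_iff₀ (Real.exp_pos x)] at h
  have key : 2 * (1 + x ^ 2 / 12) * (Real.exp x - 1) - x * (Real.exp x + 1) =
      2 * (Real.exp x * (1 - x / 2 + x ^ 2 / 12) - (1 + x / 2 + x ^ 2 / 12)) := by ring
  rw [← sub_nonneg, key]
  linarith

set_option linter.dupNamespace false in
/-- (B): `log((e^b + 1)/(e^b − 1)) ≤ log 2 − log b + b²/12` for `b > 0`. [folklore] -/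
theorem tail_log_coth_le {b : ℝ} (hb : 0 < b) :
    Real.log ((Real.exp b + 1) / (Real.exp b - 1)) ≤ Real.log 2 - Real.log b + b ^ 2 / 12 := by
  have he : 1 < Real.exp b := Real.one_lt_exp_iff.2 hb
  have hden : 0 < Real.exp b - 1 := sub_pos.2 he
  have hnum : 0 < Real.exp b + 1 := by positivity
  have hpade := tail_mul_exp_add_one_le hb.le
  have hexp : 1 + b ^ 2 / 12 ≤ Real.exp (b ^ 2 / 12) := by
    have := Real.add_one_le_exp (b ^ 2 / 12)
    linarith
  have hle : (Real.exp b + 1) / (Real.exp b - 1) ≤ 2 * Real.exp (b ^ 2 / 12) / b := by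
    rw [div_le_div_iff₀ hden hb]
    calc (Real.exp b + 1) * b = b * (Real.exp b + 1) := by ring
      _ ≤ 2 * (1 + b ^ 2 / 12) * (Real.exp b - 1) := hpade
      _ ≤ 2 * Real.exp (b ^ 2 / 12) * (Real.exp b - 1) :=
        mul_le_mul_of_nonneg_right (by linarith) hden.le
  calc Real.log ((Real.exp b + 1) / (Real.exp b - 1))
      ≤ Real.log (2 * Real.exp (b ^ 2 / 12) / b) := Real.log_le_log (by positivity) hle
    _ = Real.log 2 - Real.log b + b ^ 2 / 12 := by
      rw [Real.log_div (by positivity) hb.ne', Real.log_mul two_ne_zero (Real.exp_pos _).ne',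
        Real.log_exp]
      ring

set_option linter.dupNamespace false in
/-- `1/(2 cosh y) ≥ 1/2 − y²/4`, written as `1/2 − y²/4 ≤ (1/(1 + e^{2y})) e^y`: from
`cosh y ≤ e^{y²/2}` and `1 − y²/2 ≤ e^{−y²/2}`. [folklore] -/
theorem tail_half_sub_sq_le (y : ℝ) :
    1 / 2 - y ^ 2 / 4 ≤ 1 / (1 + Real.exp y ^ 2) * Real.exp y := by
  have hc : Real.cosh y ≤ Real.exp (y ^ 2 / 2) := Real.cosh_le_exp_half_sq y
  have hcpos : 0 < Real.cosh y := Real.cosh_pos y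
  have h1 : 1 - y ^ 2 / 2 ≤ Real.exp (-(y ^ 2 / 2)) := by
    have := Real.add_one_le_exp (-(y ^ 2 / 2))
    linarith
  have h2 : Real.exp (-(y ^ 2 / 2)) ≤ 1 / Real.cosh y := by
    rw [Real.exp_neg, le_div_iff₀ hcpos, inv_mul_le_iff₀ (Real.exp_pos _)]
    simpa using hc
  have h3 : 1 / (1 + Real.exp y ^ 2) * Real.exp y = 1 / Real.cosh y / 2 := by
    rw [Real.cosh_eq, Real.exp_neg]
    field_simp
    ring
  rw [h3]
  linarith

set_option linter.dupNamespace false in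
/-- (A): `π/4 + b/2 − b³/12 ≤ arctan(e^b)` for `b ≥ 0`. [folklore] -/
theorem tail_arctan_exp_ge {b : ℝ} (hb : 0 ≤ b) :
    Real.pi / 4 + b / 2 - b ^ 3 / 12 ≤ Real.arctan (Real.exp b) := by
  have hd : ∀ y, HasDerivAt
      (fun x : ℝ ↦ Real.arctan (Real.exp x) - (Real.pi / 4 + x / 2 - x ^ 3 / 12))
      (1 / (1 + Real.exp y ^ 2) * Real.exp y - (1 / 2 - y ^ 2 / 4)) y := by
    intro y
    have h1 : HasDerivAt (fun x : ℝ ↦ Real.arctan (Real.exp x))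
        (1 / (1 + Real.exp y ^ 2) * Real.exp y) y := (Real.hasDerivAt_exp y).arctan
    have h2 : HasDerivAt (fun x : ℝ ↦ Real.pi / 4 + x / 2 - x ^ 3 / 12) (1 / 2 - y ^ 2 / 4) y := by
      have h := ((hasDerivAt_const y (Real.pi / 4)).add ((hasDerivAt_id y).div_const 2)).sub
        ((hasDerivAt_pow 3 y).div_const 12)
      refine (h.congr_deriv ?_).congr_of_eventuallyEq (Eventually.of_forall fun x ↦ ?_)
      · norm_num
        ring
      · simp
    exact (h1.sub h2).congr_of_eventuallyEq (Eventually.of_forall fun x ↦ by simp)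
  have h := WeilGroundState.nonneg_of_hasDerivAt_nonneg hd (by simp [Real.arctan_one])
    (fun y _ ↦ by have := tail_half_sub_sq_le y; linarith) hb
  linarith

end GroundStateSimpleEven

open Set MeasureTheory Filter Complex
open scoped Real Topology ComplexConjugate

set_option linter.dupNamespace false in
/-- **Elementary bound for the archimedean tail.** For `0 < b ≤ 1`,
`π/2 − arctan(e^b) + (1/2) log((e^b+1)/(e^b−1)) ≤ π/4 + (log 2)/2 − (log b)/2 − b/2 + b²/24 + b³/12`;
the sum of (A) `arctan(e^b) ≥ π/4 + b/2 − b³/12` and (B) `log((e^b+1)/(e^b−1)) ≤ log 2 − log b + b²/12`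
(the hypothesis `b ≤ 1` is not needed). [folklore] -/
theorem stub_archTailBound :
    ∀ b : ℝ, 0 < b → b ≤ 1 →
      Real.pi / 2 - Real.arctan (Real.exp b) +
          Real.log ((Real.exp b + 1) / (Real.exp b - 1)) / 2 ≤
        Real.pi / 4 + Real.log 2 / 2 - Real.log b / 2 - b / 2 + b ^ 2 / 24 + b ^ 3 / 12 := by
  intro b hb _
  have hA := GroundStateSimpleEven.tail_arctan_exp_ge hb.le
  have hB := GroundStateSimpleEven.tail_log_coth_le hb
  linarith

end Summit.RiemannHypothesis.RiemannHypothesis.Theorems
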